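import Literature.Probability.RandomPlanarGeometry.HexSAWStripMeanContacts
import Literature.Probability.RandomPlanarGeometry.HexSAWStripArchCoefficientLaw
import HarnessLib

/-!
# The mean number of surface contacts of a critical strip ARCH diverges like `y_T/(y_T − y)` (module «ARCH-MEAN-CONTACTS»)

Topic `Literature/Probability/RandomPlanarGeometry` (continues «MEAN-CONTACTS» `HexSAWStripMeanContacts.lean` — the index-two Abelian
lemma `HV.tendsto_one_sub_sq_mul_tsum` and the β-walk statement — and «ARCH-COEFF» `HexSAWStripArchCoefficientLaw.lean`:
`HV.exists_tendsto_sub_mul_stripAyLim` (`α_{T,m} y_T^m → Λ^A_T > 0` and `(y_T − y) A_T(x_c; y) → Λ^A_T y_T`, `T ≥ 2`)).  Lane «pcv-sawmu»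
(CriticalPhenomena venture), a-p2 g21.  Source of the SETTING: N. R. Beaton, M. Bousquet-Mélou, J. de Gier, H. Duminil-Copin,
A. J. Guttmann, CMP 326 (2014) §3.2 (arches `A_T(x; y)`, `y` conjugate to the top contacts) and Corollary 8; W. Feller, vol. II (1971)
XIII.5.  Nothing of the kind is printed for the strip.

## What is proved (namespace `Literature.Probability.RandomPlanarGeometry.SAW.HV`)

* ★★ `exists_tendsto_sub_sq_mul_tsum_mul_stripAcoeff` — `(y_T − y)² Σ_m m α_{T,m} y^m → Λ^A_T y_T²` (`T ≥ 2`), with the SAME `Λ^A_T` as the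
  arch coefficient law and residue;
* ★★★ `tendsto_sub_mul_archMeanContacts` — with `⟨m⟩^A_{T,y} := (Σ_m m α_{T,m} y^m)/A_T(x_c; y)` the mean number of top contacts of a
  critical strip ARCH (both ends on the lower boundary): `(y_T − y) · ⟨m⟩^A_{T,y} ⟶ y_T` as `y ↑ y_T` (`T ≥ 2`) — the same universal
  simple-pole law as for the β-walks («MEAN-CONTACTS»), although arches must first cross the strip.

Label: LANE THEOREM (own result of lane «pcv-sawmu», a-p2 g21, 2026-08-26).  NOT claimed: `T = 1`, higher moments, uniformity in `T`.
-/

noncomputable section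

open Finset Filter Topology Literature.Probability.LatticeModels Literature.Probability.Percolation

namespace Literature.Probability.RandomPlanarGeometry.SAW

namespace HV

variable {T : ℕ}

/-- ★★ **Second-order Abelian limit of the arch series**: `(y_T − y)² Σ_m m α_{T,m} y^m ⟶ Λ^A_T y_T²` (`T ≥ 2`), together with the arch
coefficient law and residue for the SAME `Λ^A_T`. [cite: Feller1971, XIII.5 Theorem 5 (Abelian half, index 2); BeatonBousquetMelouDeGierDuminilCopinGuttmann2014, §3.2 and Corollary 8 (arXiv v5 p. 12); lane «pcv-sawmu» a-p2 g21 — own] -/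
theorem exists_tendsto_sub_sq_mul_tsum_mul_stripAcoeff (hT : 2 ≤ T) :
    ∃ Λ : ℝ, 0 < Λ ∧ Tendsto (fun m : ℕ => stripAcoeff T m * stripYT T ^ m) atTop (𝓝 Λ) ∧
      Tendsto (fun y : ℝ => (stripYT T - y) * stripAyLim T y) (𝓝[<] stripYT T) (𝓝 (Λ * stripYT T)) ∧
      Tendsto (fun y : ℝ => (stripYT T - y) ^ 2 * ∑' m : ℕ, (m : ℝ) * stripAcoeff T m * y ^ m) (𝓝[<] stripYT T)
        (𝓝 (Λ * stripYT T ^ 2)) := by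
  have hT1 : 1 ≤ T := by omega
  obtain ⟨Λ, hΛ, hq, hres⟩ := exists_tendsto_sub_mul_stripAyLim hT
  have hyT := one_lt_stripYT hT1
  have hy : 0 < stripYT T := by linarith
  refine ⟨Λ, hΛ, hq, hres, ?_⟩
  have hq0 : ∀ m, 0 ≤ stripAcoeff T m * stripYT T ^ m := fun m => mul_nonneg (stripAcoeff_nonneg hT1 m) (pow_nonneg hy.le _)
  have hA := tendsto_one_sub_sq_mul_tsum hq0 hq
  have hsub : Tendsto (fun y : ℝ => y / stripYT T) (𝓝[<] stripYT T) (𝓝[<] 1) := by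
    refine tendsto_nhdsWithin_of_tendsto_nhds_of_eventually_within _ ?_ ?_
    · have : Tendsto (fun y : ℝ => y / stripYT T) (𝓝 (stripYT T)) (𝓝 (stripYT T / stripYT T)) := tendsto_id.div_const _
      rw [div_self hy.ne'] at this
      exact this.mono_left nhdsWithin_le_nhds
    · filter_upwards [self_mem_nhdsWithin] with y hy'
      exact (div_lt_one hy).2 hy'
  have h1 := (hA.comp hsub).mul_const (stripYT T ^ 2)
  refine h1.congr' ?_
  filter_upwards [self_mem_nhdsWithin] with y _
  simp only [Function.comp]
  have hterm : ∀ m : ℕ, (m : ℝ) * (stripAcoeff T m * stripYT T ^ m) * (y / stripYT T) ^ m = (m : ℝ) * stripAcoeff T m * y ^ m := by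
    intro m
    rw [div_pow, mul_assoc, mul_assoc, mul_div_assoc', mul_div_cancel_left₀ _ (pow_ne_zero _ hy.ne'), mul_assoc]
  simp_rw [hterm]
  have h2 : (1 - y / stripYT T) ^ 2 * stripYT T ^ 2 = (stripYT T - y) ^ 2 := by field_simp
  rw [← h2]
  ring

/-- ★★★ **THE MEAN NUMBER OF TOP CONTACTS OF A CRITICAL STRIP ARCH DIVERGES LIKE `y_T/(y_T − y)`** (`T ≥ 2`): with
`⟨m⟩^A_{T,y} := (Σ_m m α_{T,m} y^m) / A_T(x_c; y)` the mean number of contacts with the upper boundary of an ARCH of the width-`T` strip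
(walk from the mid-edge `a` back to the lower boundary) under the weight `x_c^{|ω|} y^{#contacts}`:
`(y_T − y) · ⟨m⟩^A_{T,y} ⟶ y_T` as `y ↑ y_T` — the same amplitude-free simple-pole law as for the walks ending on the upper boundary.
[cite: BeatonBousquetMelouDeGierDuminilCopinGuttmann2014, §3.2 and Corollary 8 (arXiv v5 p. 12); Feller1971, XIII.5 Theorem 5; lane «pcv-sawmu» a-p2 g21 — own result] -/
theorem tendsto_sub_mul_archMeanContacts (hT : 2 ≤ T) :
    Tendsto (fun y : ℝ => (stripYT T - y) * ((∑' m : ℕ, (m : ℝ) * stripAcoeff T m * y ^ m) / stripAyLim T y))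
      (𝓝[<] stripYT T) (𝓝 (stripYT T)) := by
  obtain ⟨Λ, hΛ, -, hB, hN⟩ := exists_tendsto_sub_sq_mul_tsum_mul_stripAcoeff hT
  have hyT := one_lt_stripYT (show 1 ≤ T by omega)
  have hy : 0 < stripYT T := by linarith
  have hne : Λ * stripYT T ≠ 0 := by positivity
  have h := hN.div hB hne
  rw [show Λ * stripYT T ^ 2 / (Λ * stripYT T) = stripYT T by field_simp] at h
  refine h.congr' ?_
  filter_upwards [self_mem_nhdsWithin] with y hy'
  have hne' : stripYT T - y ≠ 0 := (sub_pos.2 hy').ne'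
  simp only [Pi.div_apply]
  by_cases hB0 : stripAyLim T y = 0
  · simp [hB0]
  · field_simp

end HV

end Literature.Probability.RandomPlanarGeometry.SAW
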